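import Mathlib
import HarnessLib

/-!
# Crux `NoZenoR` / `NoZeno` (stmt-ResolutionOfSingularities-19943 / -16483), β2 descent, `stub_L1wCore` (F1) route,
# D2′ PART 1 «UPSTAIRS FIELD & MODEL»: the base-changed affine model inside the enlarged function field

OURS (cell res-hironaka, chain W4.4; stub worker res-L0-w44-stub-2 g11; brick DAG `L1W-PREP-v2.md` ba8640c568c3f54d §2.1
D2′).  Ring level, kit-free; nothing here is a statement of the manuscript under review; AI-written, weaker than expert
review.

The thread-free core `Sig.L1Core` (res-L0-w44-lead-1, registry v28) quantifies over a model `T : Subalgebra k K` with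
`Frac T = K`.  The (F1) route base-changes the germ `D = T_P` along a local-étale `D → D[X]/(f)`; UPSTAIRS the data must again
be of the shape «subalgebra of a field».  This file builds the enlarged field `K_f := K[X]/(f)` (for `f ∈ T[X]` monic and
irreducible over `K`) and the model `T_f := T[X]/(f) ↪ K_f` as a `k`-subalgebra, and proves what the core's binders ask of
a model: `Frac T_f = K_f` and «essentially of finite type over `k`».

* `eval₂_root_map_eq_zero` — the class of `X` in `K_f` is a root of `f` read through `T → K → K_f`;
* `injective_liftAlgHom_root` — `T[X]/(f) → K_f` is injective (`f` monic, `K = Frac T` ⊇ `T`);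
* `exists_splitModel` — **∃ `T_f : Subalgebra k K_f` with `AdjoinRoot f ≃ₐ[k] T_f` (sending `root f` to the class of
  `X` and `t ∈ T` to its image in `K_f` — which pins the `T`-structure), `IsFractionRing T_f K_f`,
  `Algebra.EssFiniteType k T_f` (from `EssFiniteType k T`)**;
* `irreducible_map_of_irreducible_map_residue` — Gauss: if `T` is integrally closed and `f` is irreducible modulo a
  maximal ideal `𝔪` of `T` then `f` is irreducible over `K` (Mathlib `Monic.irreducible_of_irreducible_map` +
  `Monic.irreducible_iff_irreducible_map_fraction_map`).
-/

noncomputable section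

-- single-problem summit: the doubled namespace component `ResolutionOfSingularities` is forced
set_option linter.dupNamespace false

namespace Summit.ResolutionOfSingularities.ResolutionOfSingularities.Theorems.NoZeno.SplittingBase

open Polynomial AdjoinRoot

variable {k K : Type} [Field k] [Field K] [Algebra k K]

/-- The class of `X` in `K[X]/(f_K)` is a root of `f ∈ T[X]` through `T → K → K[X]/(f_K)`. [folklore] -/
theorem eval₂_root_map_eq_zero (T : Subalgebra k K) (f : (↥T)[X]) :
    f.eval₂ (algebraMap ↥T (AdjoinRoot (f.map (algebraMap ↥T K))))
      (root (f.map (algebraMap ↥T K))) = 0 := by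
  rw [← aeval_def, ← aeval_map_algebraMap K (root (f.map (algebraMap ↥T K))) f, AdjoinRoot.aeval_eq,
    AdjoinRoot.mk_self]

/-- **`T[X]/(f) → K[X]/(f_K)` is injective** for `f ∈ T[X]` monic (`T ⊆ K` a subring of a field): a polynomial over `T`
divisible by `f` over `K` is divisible by `f` over `T` (`Polynomial.map_dvd_map`). [folklore] -/
theorem injective_liftAlgHom_root (T : Subalgebra k K) (f : (↥T)[X]) (hf : f.Monic) :
    Function.Injective (liftAlgHom f (Algebra.ofId ↥T (AdjoinRoot (f.map (algebraMap ↥T K))))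
      (root (f.map (algebraMap ↥T K))) (eval₂_root_map_eq_zero T f)) := by
  set φ := liftAlgHom f (Algebra.ofId ↥T (AdjoinRoot (f.map (algebraMap ↥T K))))
      (root (f.map (algebraMap ↥T K))) (eval₂_root_map_eq_zero T f) with hφ
  rw [injective_iff_map_eq_zero]
  intro x hx
  induction x using AdjoinRoot.induction_on with
  | ih g =>
    rw [liftAlgHom_mk] at hx
    -- `g(root) = 0` in `K[X]/(f_K)` means `f_K ∣ g_K`, hence `f ∣ g` (`f` monic)
    have h1 : aeval (root (f.map (algebraMap ↥T K))) (g.map (algebraMap ↥T K)) = 0 := by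
      rw [aeval_map_algebraMap, aeval_def]
      exact hx
    have hinj : Function.Injective (algebraMap ↥T K) := fun a b h => Subtype.ext h
    rw [AdjoinRoot.aeval_eq, AdjoinRoot.mk_eq_zero, Polynomial.map_dvd_map _ hinj hf] at h1
    exact AdjoinRoot.mk_eq_zero.mpr h1

/-- **The upstairs model.**  For `T : Subalgebra k K` with `Frac T = K`, essentially of finite type over `k`, and
`f ∈ T[X]` monic with `f_K := f.map (T → K)` irreducible: inside the field `K_f := K[X]/(f_K)` there is a `k`-subalgebra
`T_f`, isomorphic over `T` to `T[X]/(f)` (the class of `X` going to the class of `X`), with `Frac T_f = K_f` and `T_f`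
essentially of finite type over `k`. [this work] -/
theorem exists_splitModel (T : Subalgebra k K) [IsFractionRing ↥T K] [Algebra.EssFiniteType k ↥T]
    (f : (↥T)[X]) (hf : f.Monic) [Fact (Irreducible (f.map (algebraMap ↥T K)))] :
    ∃ (Tf : Subalgebra k (AdjoinRoot (f.map (algebraMap ↥T K)))) (e : AdjoinRoot f ≃ₐ[k] ↥Tf),
      ((e (root f) : AdjoinRoot (f.map (algebraMap ↥T K))) = root (f.map (algebraMap ↥T K))) ∧
      (∀ t : ↥T, ((e (of f t)) : AdjoinRoot (f.map (algebraMap ↥T K))) = algebraMap K _ (t : K)) ∧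
      IsFractionRing ↥Tf (AdjoinRoot (f.map (algebraMap ↥T K))) ∧
      Algebra.EssFiniteType k ↥Tf := by
  set fK := f.map (algebraMap ↥T K) with hfK
  set Kf := AdjoinRoot fK with hKf
  set φ : AdjoinRoot f →ₐ[↥T] Kf :=
    liftAlgHom f (Algebra.ofId ↥T Kf) (root fK) (eval₂_root_map_eq_zero T f) with hφ
  have hφinj : Function.Injective φ := injective_liftAlgHom_root T f hf
  -- the model: the range of `φ` over `k`
  let φk : AdjoinRoot f →ₐ[k] Kf := φ.restrictScalars k
  have hφk : ∀ x, φk x = φ x := fun _ => rfl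
  have hφkinj : Function.Injective φk := fun a b h => hφinj h
  let Tf : Subalgebra k Kf := φk.range
  let e : AdjoinRoot f ≃ₐ[k] ↥Tf := AlgEquiv.ofInjective φk hφkinj
  have he : ∀ x, ((e x : ↥Tf) : Kf) = φ x := fun x => rfl
  refine ⟨Tf, e, ?_, ?_, ?_, ?_⟩
  · rw [he, hφ, liftAlgHom_root]
  · intro t
    rw [he, hφ, liftAlgHom_of]
    rfl
  · -- `Frac T_f = K_f`: every element of `K_f` is `(class of g₀)/b` with `g₀ ∈ T[X]`, `b ∈ T`
    refine IsFractionRing.of_field ↥Tf Kf fun z => ?_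
    obtain ⟨g, rfl⟩ := AdjoinRoot.mk_surjective (g := fK) z
    obtain ⟨b, hbM, hb⟩ := IsLocalization.integerNormalization_spec (nonZeroDivisors ↥T) g
    have hb0 : ((b : ↥T) : K) ≠ 0 := by
      have := nonZeroDivisors.ne_zero hbM
      exact fun h => this (Subtype.ext h)
    refine ⟨⟨φ (AdjoinRoot.mk f (IsLocalization.integerNormalization (nonZeroDivisors ↥T) g)), ⟨_, rfl⟩⟩,
      ⟨φ (of f b), ⟨_, rfl⟩⟩, ?_⟩
    show AdjoinRoot.mk fK g =
      φ (AdjoinRoot.mk f (IsLocalization.integerNormalization (nonZeroDivisors ↥T) g)) / φ (of f b)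
    rw [hφ, liftAlgHom_mk, liftAlgHom_of]
    have hb' : (IsLocalization.integerNormalization (nonZeroDivisors ↥T) g).map (algebraMap ↥T K)
        = C ((b : ↥T) : K) * g := by
      rw [hb, Algebra.smul_def, Polynomial.algebraMap_apply]
      rfl
    have h1 : eval₂ (↑(Algebra.ofId ↥T Kf)) (root fK) (IsLocalization.integerNormalization (nonZeroDivisors ↥T) g)
        = algebraMap K Kf (b : K) * AdjoinRoot.mk fK g := by
      change eval₂ (algebraMap ↥T Kf) (root fK) _ = _
      rw [← aeval_def, ← aeval_map_algebraMap K (root fK), hb', map_mul, aeval_C, AdjoinRoot.aeval_eq]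
    have h2 : (Algebra.ofId ↥T Kf) b = algebraMap K Kf (b : K) :=
      IsScalarTower.algebraMap_apply ↥T K Kf _
    rw [h1, h2, mul_div_cancel_left₀ _ ((map_ne_zero_iff _ (algebraMap K Kf).injective).mpr hb0)]
  · -- essentially of finite type over `k`: `T_f ≅ T[X]/(f)`, of finite type over `T`
    haveI : Algebra.FiniteType ↥T (AdjoinRoot f) := inferInstance
    haveI : Algebra.EssFiniteType ↥T (AdjoinRoot f) := inferInstance
    haveI : Algebra.EssFiniteType k (AdjoinRoot f) := Algebra.EssFiniteType.comp k ↥T (AdjoinRoot f)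
    exact Algebra.EssFiniteType.of_surjective e.toAlgHom e.surjective

/-- **Gauss's lemma for the splitting polynomial**: over an integrally closed model `T` with `Frac T = K`, a monic
`f ∈ T[X]` whose reduction modulo a maximal ideal `𝔪` is irreducible is irreducible over `K` (so `K[X]/(f_K)` is a
field). [folklore] -/
theorem irreducible_map_of_irreducible_map_residue (T : Subalgebra k K) [IsFractionRing ↥T K]
    [IsIntegrallyClosed ↥T] (f : (↥T)[X]) (hf : f.Monic) (𝔪 : Ideal ↥T) [𝔪.IsMaximal]
    (hirr : Irreducible (f.map (Ideal.Quotient.mk 𝔪))) : Irreducible (f.map (algebraMap ↥T K)) := by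
  letI := Ideal.Quotient.field 𝔪
  have hfT : Irreducible f := hf.irreducible_of_irreducible_map (Ideal.Quotient.mk 𝔪) f hirr
  exact (hf.irreducible_iff_irreducible_map_fraction_map).mp hfT

/-! ## D2′ PART 2 (first piece): the `𝔪`-primary binder survives the unramified local base change

UPSTAIRS, over the splitting base `D → D_B` (local, `𝔪_D·D_B = 𝔪_(D_B)`, res-D-pv-039's `SplittingBase` bundle), the
blown-up ideal of `Sig.L1Core` is the extension `(span C)·D_B`; its radical is again the maximal ideal. -/

open IsLocalRing in
/-- **The `𝔪`-primary binder transfers along an unramified local base change**: for local rings `A → B` with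
`𝔪_A·B = 𝔪_B`, `A` Noetherian, and an ideal `I ≤ A` with `√I = 𝔪_A`, the extended ideal has `√(I·B) = 𝔪_B`.
[this work] -/
theorem radical_map_eq_maximalIdeal_of_map_maximalIdeal_eq {A B : Type*} [CommRing A] [CommRing B]
    [IsLocalRing A] [IsLocalRing B] [IsNoetherianRing A] (φ : A →+* B)
    (hφ : (maximalIdeal A).map φ = maximalIdeal B) {I : Ideal A} (hI : I.radical = maximalIdeal A) :
    (I.map φ).radical = maximalIdeal B := by
  apply le_antisymm
  · -- `I ≤ 𝔪_A`, so `I·B ≤ 𝔪_A·B = 𝔪_B`, a prime ideal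
    have hIle : I ≤ maximalIdeal A := hI ▸ Ideal.le_radical
    calc (I.map φ).radical ≤ ((maximalIdeal A).map φ).radical := Ideal.radical_mono (Ideal.map_mono hIle)
      _ = maximalIdeal B := by rw [hφ]; exact (maximalIdeal.isMaximal B).isPrime.radical
  · -- `𝔪_A^N ≤ I` for some `N` (Noetherian), so `𝔪_B^N = (𝔪_A·B)^N ≤ I·B`
    have hle : maximalIdeal A ≤ I.radical := hI ▸ le_rfl
    obtain ⟨N, hN⟩ := Ideal.exists_pow_le_of_le_radical_of_fg hle (IsNoetherian.noetherian _)
    have hpow : maximalIdeal B ^ N ≤ I.map φ := by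
      rw [← hφ, ← Ideal.map_pow]
      exact Ideal.map_mono hN
    intro x hx
    exact ⟨N, hpow (Ideal.pow_mem_pow hx N)⟩

/-- Bookkeeping: the extension of a span is the span of the image. [folklore] -/
theorem map_span_image {A B : Type*} [CommRing A] [CommRing B] (φ : A →+* B) (S : Set A) :
    (Ideal.span S).map φ = Ideal.span (φ '' S) :=
  Ideal.map_span φ S

end Summit.ResolutionOfSingularities.ResolutionOfSingularities.Theorems.NoZeno.SplittingBase

end
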